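import Mathlib
import HarnessLib
import Literature.Analysis.FluidPDE.SuitableWeak
import Literature.Analysis.FluidPDE.SelfSimilar
import Literature.Analysis.FluidPDE.LocalTypeI
import Literature.Analysis.FluidPDE.ESSLocalHolderNoConcentration
import Summits.NavierStokesRegularity.NavierStokesRegularity.Theorems.RellichScarNoMildScar
import Summits.NavierStokesRegularity.NavierStokesRegularity.Theorems.RellichScarApexLocalisationHalfspaceStripLiouville

/-!
# Route `RellichScar`, crux `ApexLocalisation` (stmt-NavierStokesRegularity-11719) support — and KIT part 1 of the STAGED door
# S15 `LocalIrrotationalScarDoor` (nsreg-p1 ROUND-14): the far-field vorticity vanishes beyond a half-space from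
# TOP-VANISHING OF THE VORTICITY ALONE

This is the tree's `…Theorems.RellichScarApexLocalisation.stub_halfspaceFarFieldCurl`
(`RellichScarApexLocalisationHalfspaceFarFieldCurl.lean`, ESS 2003 §3 (3.31)–(3.32) + Thm 5.1) with its top
hypothesis MOVED FROM THE VELOCITY TO THE VORTICITY: instead of a field `w` (a.e. equal to `U`) whose slices tend
weakly to zero at the top, we assume only that `curl U(s, ·)` tends to zero at the top locally uniformly near every
point of `S` — the velocity `U` itself is free (bounded with three bounded derivatives, nothing at the top).  The
proof is the tree's verbatim except that the call to `exists_uniform_small_near_top` (which produced smallness of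
`U` AND `DU` near the top, of which only the `DU` half was used, to bound `|ω| ≤ ‖curl‖·θ`) is replaced by the
hypothesis.  (Backward uniqueness sees the final VORTICITY only.)

Source: nsreg-p1 g12's kit `HOME/ns-regularity-ideate-p1/r14/IrrotScarKit.lean` (sha16 0fabdd243612eba0), part 1,
landed verbatim by nsreg-p6 g7 (namespace moved from `Theses.LocalIrrotationalScarDoor.Kit` to this Theorems module,
local notations expanded); helper `--supports stmt-NavierStokesRegularity-11719` (a genuine generalisation of the
calm-cone Carleman engine of the `RellichScar` apex-localisation files).  Sequel: `…IrrotHalfspaceLiouville` (kit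
parts 2–3: the irrotational-half-space-scar Liouville theorem = the residue `K2Rep` of S15).

WHAT THIS IS NOT: not NS regularity; not the S15 zoom crux `K1Rep` (open).
-/

noncomputable section

-- the summit and its single sub-problem share the name (CONVENTIONS §1), as in every Theorems file
set_option linter.dupNamespace false

namespace Summit.NavierStokesRegularity.NavierStokesRegularity.Theorems.RellichScarApexLocalisationHalfspaceFarFieldCurlOfTopCurl
open Summit.NavierStokesRegularity.NavierStokesRegularity.Theorems.RellichScarApexLocalisation
open Summit.NavierStokesRegularity.NavierStokesRegularity.Theorems.RellichScarNoMildScar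

open MeasureTheory Set Function Metric Filter Topology TopologicalSpace
open scoped ENNReal NNReal InnerProductSpace RealInnerProductSpace
open Literature.Analysis Literature.Analysis.FluidPDE

set_option maxHeartbeats 1600000 in
/-- **The far-field vorticity vanishes beyond a half-space** (Escauriaza–Seregin–Šverák 2003,
§3, (3.31)–(3.32): "`ω = 0` on `(ℝ³ ∖ B̄(R)) × ]-T₂, 0[`" by backward uniqueness in half-spaces,
Thm. 5.1), in the geometry of an arbitrary open far region.  Setting: `S ⊆ ℝ³` is open and
contains the open half-space `x₀ + {y | 0 < ⟪y, e⟫}` (`‖e‖ = 1`); `U` is the smooth-in-space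
representative of `w` on `Ω = ]-1, 0[ × S` — a distributional solution `(U, π)` of the
Navier–Stokes system there with `C⁴` slices, jointly continuous spatial derivatives `D_xⁿU`,
`n ≤ 4`, and `‖D_xⁿU‖ ≤ K`, `n ≤ 3` — and the slices of `w` tend weakly to zero at the top time.
Then `curl U(t, ·) = 0` at every point of `]-1, 0[ × {x | ⟪x₀, e⟫ < ⟪x, e⟫}`.
Proof: the vorticity `ω = curl U` is of the class `C¹ ∩ {∂ₓω ∈ C¹}` and satisfies
`|∂ₜω - Δω| ≤ 2K(|ω| + |∇ω|)` (`vorticity_carleman_inequality`), is bounded, and tends to zero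
at the top uniformly near every point of `S` (`exists_uniform_small_near_top`); the
time-reversed, normalised, translated field `u(s, y) = c₀ ω(-s, x₀ + y)` extended by `0` at
`s = 0` satisfies every hypothesis of the half-space backward uniqueness theorem in that class
(`Carleman.backwardUniqueness_uncurried_c12`, with `Carleman.uniqueContinuation_uncurried_c12`
as its unique-continuation input), hence vanishes on `]0, 1[ × {⟪y, e⟫ > 0}`.  This is the
tree's `farField_curl_eq_zero` with `(closedBall 0 R)ᶜ`, `(R + 1) • e` replaced by `S`, `x₀`.
[cite: EscauriazaSereginSverak2003, §3 (3.31)-(3.32) and Thm. 5.1] -/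
theorem halfspaceFarFieldCurl_of_topCurlVanishing :
    ∀ (S : Set (EuclideanSpace ℝ (Fin 3))) (hS : IsOpen S) (x₀ e : (EuclideanSpace ℝ (Fin 3))), ‖e‖ = 1 → (∀ y : (EuclideanSpace ℝ (Fin 3)), 0 < ⟪y, e⟫ → x₀ + y ∈ S) →
      ∀ (U : ℝ → (EuclideanSpace ℝ (Fin 3)) → (EuclideanSpace ℝ (Fin 3))) (π : ℝ → (EuclideanSpace ℝ (Fin 3)) → ℝ) (K : ℝ),
      (∀ x₁ ∈ S, ∀ θ : ℝ, 0 < θ → ∃ s₀ δ : ℝ, s₀ < 0 ∧ (-1 : ℝ) ≤ s₀ ∧ 0 < δ ∧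
        ∀ s ∈ Ioo s₀ 0, ∀ x ∈ ball x₁ δ, ‖curl (U s) x‖ ≤ θ) →
      IsDistributionalNSSolutionOn ⟨Ioo (-1 : ℝ) 0 ×ˢ S, isOpen_Ioo.prod hS⟩ 1 0 U π →
      (∀ t ∈ Ioo (-1 : ℝ) 0, ContDiffOn ℝ 4 (U t) S) →
      (∀ n ≤ 4, ContinuousOn (fun z : ℝ × (EuclideanSpace ℝ (Fin 3)) => iteratedFDeriv ℝ n (U z.1) z.2) (Ioo (-1 : ℝ) 0 ×ˢ S)) →
      (∀ n ≤ 3, ∀ z ∈ Ioo (-1 : ℝ) 0 ×ˢ S, ‖iteratedFDeriv ℝ n (U z.1) z.2‖ ≤ K) →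
      ∀ z ∈ Ioo (-1 : ℝ) 0 ×ˢ {x : (EuclideanSpace ℝ (Fin 3)) | ⟪x₀, e⟫ < ⟪x, e⟫}, curl (U z.1) z.2 = 0 := by
  intro S hS x₀ e he hx₀S U π K htopc hsol hU4 hΦ hK
  -- ### notation and basic facts
  set I : Set ℝ := Ioo (-1 : ℝ) 0 with hI
  have hIo : IsOpen I := isOpen_Ioo
  set O : Set (ℝ × (EuclideanSpace ℝ (Fin 3))) := I ×ˢ S with hOdef
  have hOo : IsOpen O := hIo.prod hS
  have hee : (0 : ℝ) < ⟪e, e⟫ := by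
    rw [real_inner_self_eq_norm_sq, he]; norm_num
  have hK0 : 0 ≤ K := by
    have hz : ((-(1 : ℝ) / 2, x₀ + e) : ℝ × (EuclideanSpace ℝ (Fin 3))) ∈ O := ⟨⟨by norm_num, by norm_num⟩, hx₀S e hee⟩
    exact (norm_nonneg _).trans (hK 0 (by norm_num) _ hz)
  -- bounds on `U` and `D U` in the usual form
  have hK₀ : ∀ z ∈ O, ‖U z.1 z.2‖ ≤ K := fun z hz => by
    have h := hK 0 (by norm_num) z hz
    rwa [norm_iteratedFDeriv_zero] at h
  have hK₁ : ∀ z ∈ O, ‖fderiv ℝ (U z.1) z.2‖ ≤ K := fun z hz => by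
    have h := hK 1 (by norm_num) z hz
    rwa [norm_iteratedFDeriv_one] at h
  -- ### the vorticity: class, equation, bounds
  obtain ⟨-, hU0, -, hω1, hωx⟩ :=
    vorticity_c12_of_isDistributionalNSSolutionOn hIo hS hsol hU4 hΦ
  obtain ⟨hdt, -, hineq⟩ := vorticity_carleman_inequality hIo hS hsol hU4 hΦ hK₀ hK₁
  have hκ0 : 0 ≤ ‖curlCLM‖ := ContinuousLinearMap.opNorm_nonneg _
  -- pointwise bounds: `|ω| ≤ ‖curlCLM‖K`, `|∂ₜω| ≤ (3 * 1 * ‖curlCLM‖ * K + 2 * ‖curlCLM‖ * K ^ 2)`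
  have hbounds : ∀ z ∈ O, ‖(uncurry (vorticity U)) z‖ ≤ ‖curlCLM‖ * K ∧
      ‖Carleman.dt (uncurry (vorticity U)) z‖ ≤ (3 * 1 * ‖curlCLM‖ * K + 2 * ‖curlCLM‖ * K ^ 2) := by
    intro z hz
    have hU3 : ContDiffOn ℝ 3 (U z.1) S := (hU4 z.1 hz.1).of_le (by norm_cast)
    obtain ⟨b0, -, -, b3⟩ := vorticity_pointwise_bounds hS hU3 hz.2 hK0 zero_le_one
      (hK₀ z hz) (hK₁ z hz) (hK 2 (by norm_num) z hz) (hK 3 le_rfl z hz)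
    refine ⟨?_, ?_⟩
    · show ‖vorticity U z.1 z.2‖ ≤ _
      simpa [vorticity_apply] using b0
    · rw [hdt z hz]
      simpa [vorticity_apply] using b3
  -- ### uniform smallness at the top
  have hsmall := htopc
  -- ### the half-space `H = {⟪y, e⟫ > 0}` and the cylinder `Q = ]0, 1[ × H`
  set H : Set (EuclideanSpace ℝ (Fin 3)) := {y : (EuclideanSpace ℝ (Fin 3)) | 0 < ⟪y, e⟫} with hHdef
  have hHo : IsOpen H := isOpen_lt continuous_const (continuous_id.inner continuous_const)
  set Q : Set (ℝ × (EuclideanSpace ℝ (Fin 3))) := Ioo (0 : ℝ) 1 ×ˢ H with hQdef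
  have hQo : IsOpen Q := isOpen_Ioo.prod hHo
  -- the affine change of variables `A(s, y) = (-s, x₀ + y)`
  set A : ℝ × (EuclideanSpace ℝ (Fin 3)) → ℝ × (EuclideanSpace ℝ (Fin 3)) := stAffine (-1) 1 0 x₀ with hAdef
  have hA : ∀ z : ℝ × (EuclideanSpace ℝ (Fin 3)), A z = (-z.1, x₀ + z.2) := fun z => by
    simp [hAdef, stAffine]
  have hAO : ∀ z ∈ Q, A z ∈ O := by
    rintro ⟨s', y⟩ ⟨hs', hy⟩
    rw [hA]
    exact ⟨⟨by linarith [hs'.2], by linarith [hs'.1]⟩, hx₀S y hy⟩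
  have hpre : Q ⊆ A ⁻¹' O := fun z hz => hAO z hz
  -- the normalised, time-reversed vorticity
  set c₀ : ℝ := (‖curlCLM‖ * K + 1)⁻¹ with hc₀def
  have hc₀ : 0 < c₀ := by positivity
  have hc₀1 : c₀ * (‖curlCLM‖ * K) ≤ 1 := by
    rw [hc₀def, inv_mul_le_iff₀ (by positivity)]
    linarith
  set ut : ℝ × (EuclideanSpace ℝ (Fin 3)) → (EuclideanSpace ℝ (Fin 3)) := fun z => c₀ • (uncurry (vorticity U)) (A z) with hutdef
  set u : ℝ × (EuclideanSpace ℝ (Fin 3)) → (EuclideanSpace ℝ (Fin 3)) := fun z => if 0 < z.1 then ut z else 0 with hudef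
  have huQ : ∀ z ∈ Q, u z = ut z := fun z hz => if_pos hz.1.1
  -- ### regularity of `ut` and `u` on `Q`
  have hut1 : ContDiffOn ℝ 1 ut Q :=
    ((Carleman.contDiffOn_comp_stAffine hω1 (-1) 1 0 x₀).const_smul c₀).mono hpre
  have hdxut : ∀ e' : (EuclideanSpace ℝ (Fin 3)), Carleman.dx e' ut =
      fun z => c₀ • Carleman.dx e' (uncurry (vorticity U)) (A z) := by
    intro e'
    rw [hutdef, Carleman.dx_const_smul_eq]
    funext z
    rw [Carleman.dx_comp_stAffine (by norm_num) one_ne_zero (uncurry (vorticity U)) e' z, one_smul]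
  have hutx : ∀ e' : (EuclideanSpace ℝ (Fin 3)), ContDiffOn ℝ 1 (Carleman.dx e' ut) Q := by
    intro e'
    rw [hdxut e']
    exact ((Carleman.contDiffOn_comp_stAffine (hωx e') (-1) 1 0 x₀).const_smul c₀).mono hpre
  have hframe : ∀ z ∈ Q, Carleman.dt u z = Carleman.dt ut z ∧
      (∀ e', Carleman.dx e' u z = Carleman.dx e' ut z) ∧
      (∀ e', Carleman.dx e' (Carleman.dx e' u) z = Carleman.dx e' (Carleman.dx e' ut) z) ∧
      Carleman.lap u z = Carleman.lap ut z ∧ Carleman.gradSq u z = Carleman.gradSq ut z :=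
    fun z hz => Carleman.frame_eq_of_eventuallyEq hQo hz huQ
  have hu1 : ContDiffOn ℝ 1 u Q := hut1.congr huQ
  have hux : ∀ e' : (EuclideanSpace ℝ (Fin 3)), ContDiffOn ℝ 1 (Carleman.dx e' u) Q := fun e' =>
    (hutx e').congr fun z hz => (hframe z hz).2.1 e'
  -- frame operators of `ut` in terms of those of `(uncurry (vorticity U))`
  have hdtut : ∀ z, Carleman.dt ut z =
      c₀ • ((-1 : ℝ) • Carleman.dt (uncurry (vorticity U)) (A z)) := fun z => by
    rw [hutdef, Carleman.dt_const_smul_apply, Carleman.dt_comp_stAffine (by norm_num) one_ne_zero]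
  have hlaput : ∀ z, Carleman.lap ut z = c₀ • Carleman.lap (uncurry (vorticity U)) (A z) := fun z => by
    rw [hutdef, Carleman.lap_const_smul_apply, Carleman.lap_comp_stAffine (by norm_num) one_ne_zero,
      one_pow, one_smul]
  have hgradut : ∀ z, Carleman.gradSq ut z =
      c₀ ^ 2 * Carleman.gradSq (uncurry (vorticity U)) (A z) := fun z => by
    rw [hutdef, Carleman.gradSq_const_smul_apply,
      Carleman.gradSq_comp_stAffine (by norm_num) one_ne_zero, one_pow, one_mul]
  have hnormut : ∀ z, ‖ut z‖ = c₀ * ‖(uncurry (vorticity U)) (A z)‖ := fun z => by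
    rw [hutdef, norm_smul, Real.norm_eq_abs, abs_of_pos hc₀]
  have hsqrtut : ∀ z, Real.sqrt (Carleman.gradSq ut z) =
      c₀ * Real.sqrt (Carleman.gradSq (uncurry (vorticity U)) (A z)) :=
    fun z => by rw [hgradut, Real.sqrt_mul (sq_nonneg _), Real.sqrt_sq hc₀.le]
  -- ### (hBH) the differential inequality
  have hBH : ∀ z ∈ Q, ‖Carleman.dt u z + Carleman.lap u z‖ ≤
      (2 * K) * (‖u z‖ + Real.sqrt (Carleman.gradSq u z)) := by
    intro z hz
    obtain ⟨h1, -, -, h4, h5⟩ := hframe z hz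
    rw [h1, h4, h5, huQ z hz, hdtut, hlaput, hnormut, hsqrtut]
    have e1 : c₀ • ((-1 : ℝ) • Carleman.dt (uncurry (vorticity U)) (A z)) +
        c₀ • Carleman.lap (uncurry (vorticity U)) (A z) =
        -(c₀ • (Carleman.dt (uncurry (vorticity U)) (A z) -
          Carleman.lap (uncurry (vorticity U)) (A z))) := by
      simp only [smul_sub, neg_one_smul, smul_neg]
      abel
    rw [e1, norm_neg, norm_smul, Real.norm_eq_abs, abs_of_pos hc₀]
    have h := hineq (A z) (hAO z hz)
    calc c₀ * ‖Carleman.dt (uncurry (vorticity U)) (A z) - Carleman.lap (uncurry (vorticity U)) (A z)‖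
        ≤ c₀ * ((K + K) * (‖(uncurry (vorticity U)) (A z)‖ +
            Real.sqrt (Carleman.gradSq (uncurry (vorticity U)) (A z)))) :=
          mul_le_mul_of_nonneg_left h hc₀.le
      _ = (2 * K) * (c₀ * ‖(uncurry (vorticity U)) (A z)‖ +
            c₀ * Real.sqrt (Carleman.gradSq (uncurry (vorticity U)) (A z))) := by ring
  -- ### (hgrowth), (h0)
  have hgrowth : ∀ z ∈ Q, ‖u z‖ ≤ Real.exp (0 * ‖z.2‖ ^ 2) := by
    intro z hz
    rw [zero_mul, Real.exp_zero, huQ z hz, hnormut]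
    calc c₀ * ‖(uncurry (vorticity U)) (A z)‖
        ≤ c₀ * (‖curlCLM‖ * K) := mul_le_mul_of_nonneg_left (hbounds _ (hAO z hz)).1 hc₀.le
      _ ≤ 1 := hc₀1
  have h0 : ∀ y : (EuclideanSpace ℝ (Fin 3)), 0 < ⟪y, e⟫ → u (0, y) = 0 := fun y _ => if_neg (lt_irrefl 0)
  -- ### (hH3) square integrability of `∂ₜu` on bounded sets
  have hH3 : ∀ K' ⊆ Q, Bornology.IsBounded K' → MeasurableSet K' →
      ∫⁻ z in K', ‖Carleman.dt u z‖ₑ ^ 2 < ∞ := by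
    intro K' hK' hK'b hK'm
    have hbd : ∀ z ∈ K', ‖Carleman.dt u z‖ₑ ^ 2 ≤
        ENNReal.ofReal ((c₀ * (3 * 1 * ‖curlCLM‖ * K + 2 * ‖curlCLM‖ * K ^ 2)) ^ 2) := by
      intro z hz
      have hzQ := hK' hz
      rw [(hframe z hzQ).1, hdtut]
      have hn : ‖c₀ • ((-1 : ℝ) • Carleman.dt (uncurry (vorticity U)) (A z))‖ ≤
          c₀ * (3 * 1 * ‖curlCLM‖ * K + 2 * ‖curlCLM‖ * K ^ 2) := by
        rw [norm_smul, norm_smul, Real.norm_eq_abs, abs_of_pos hc₀, Real.norm_eq_abs, abs_neg,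
          abs_one, one_mul]
        exact mul_le_mul_of_nonneg_left (hbounds _ (hAO z hzQ)).2 hc₀.le
      calc ‖c₀ • ((-1 : ℝ) • Carleman.dt (uncurry (vorticity U)) (A z))‖ₑ ^ 2
          = ENNReal.ofReal (‖c₀ • ((-1 : ℝ) • Carleman.dt (uncurry (vorticity U)) (A z))‖ ^ 2) := by
            rw [← ofReal_norm, ENNReal.ofReal_pow (norm_nonneg _)]
        _ ≤ ENNReal.ofReal ((c₀ * (3 * 1 * ‖curlCLM‖ * K + 2 * ‖curlCLM‖ * K ^ 2)) ^ 2) :=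
            ENNReal.ofReal_le_ofReal (pow_le_pow_left₀ (norm_nonneg _) hn 2)
    calc ∫⁻ z in K', ‖Carleman.dt u z‖ₑ ^ 2
        ≤ ∫⁻ _ in K', ENNReal.ofReal ((c₀ * (3 * 1 * ‖curlCLM‖ * K + 2 * ‖curlCLM‖ * K ^ 2)) ^ 2) :=
          setLIntegral_mono' hK'm hbd
      _ = ENNReal.ofReal ((c₀ * (3 * 1 * ‖curlCLM‖ * K + 2 * ‖curlCLM‖ * K ^ 2)) ^ 2) * volume K' :=
          setLIntegral_const _ _
      _ < ∞ := ENNReal.mul_lt_top ENNReal.ofReal_lt_top hK'b.measure_lt_top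
  -- ### (hcont) continuity up to the initial plane
  have hutcQ : ∀ z ∈ Q, ContinuousAt ut z := by
    intro z hz
    have h1 : ContinuousAt (uncurry (vorticity U)) (A z) :=
      hω1.continuousOn.continuousAt (hOo.mem_nhds (hAO z hz))
    have h2 : ContinuousAt A z := (continuous_stAffine (-1 : ℝ) 1 0 x₀).continuousAt
    exact (h1.comp_of_eq h2 rfl).const_smul c₀
  have hcont : ContinuousOn u (Ico (0 : ℝ) 1 ×ˢ H) := by
    rintro ⟨s', y⟩ ⟨hs', hy⟩
    rcases (hs'.1).eq_or_lt with h0s | hspos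
    · -- the bottom `s' = 0`
      subst h0s
      rw [Metric.continuousWithinAt_iff]
      intro ε hε
      set θ : ℝ := ε / (2 * (c₀ + 1)) with hθdef
      have hθ : 0 < θ := by positivity
      have hθε : c₀ * θ < ε := by
        have h1 : c₀ * θ ≤ (c₀ + 1) * θ := by nlinarith
        have h2 : (c₀ + 1) * θ = ε / 2 := by rw [hθdef]; field_simp
        linarith
      obtain ⟨s₀, δ₁, hs₀, -, hδ₁, hsm⟩ := hsmall (x₀ + y) (hx₀S y hy) θ hθ
      refine ⟨min (-s₀) δ₁, lt_min (by linarith) hδ₁, ?_⟩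
      rintro ⟨s'', y'⟩ ⟨hs'', hy'⟩ hdist
      rw [Prod.dist_eq, max_lt_iff] at hdist
      obtain ⟨hd1, hd2⟩ := hdist
      rw [Real.dist_eq, sub_zero] at hd1
      have hu0 : u (0, y) = 0 := if_neg (lt_irrefl 0)
      rw [hu0, dist_zero_right]
      rcases (hs''.1).eq_or_lt with h0 | hpos
      · have hs0 : s'' = 0 := by simpa using h0.symm
        have : u (s'', y') = 0 := by
          show (if (0 : ℝ) < s'' then ut (s'', y') else 0) = 0
          rw [hs0, if_neg (lt_irrefl 0)]
        rw [this, norm_zero]; exact hε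
      · have hzQ : ((s'', y') : ℝ × (EuclideanSpace ℝ (Fin 3))) ∈ Q := ⟨⟨hpos, hs''.2⟩, hy'⟩
        rw [huQ _ hzQ, hnormut, hA]
        have hs''abs : |s''| = s'' := abs_of_pos hpos
        have hneg : -s'' ∈ Ioo s₀ 0 := ⟨by
            have : s'' < -s₀ := by rw [← hs''abs]; exact hd1.trans_le (min_le_left _ _)
            linarith, by linarith⟩
        have hball : x₀ + y' ∈ ball (x₀ + y) δ₁ := by
          rw [mem_ball, dist_eq_norm, add_sub_add_left_eq_sub, ← dist_eq_norm]
          exact hd2.trans_le (min_le_right _ _)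
        have hD := hsm (-s'') hneg (x₀ + y') hball
        have hω : ‖(uncurry (vorticity U)) (-s'', x₀ + y')‖ ≤ θ := by
          show ‖vorticity U (-s'') (x₀ + y')‖ ≤ θ
          rw [vorticity_apply]
          exact hD
        calc c₀ * ‖(uncurry (vorticity U)) (-s'', x₀ + y')‖
            ≤ c₀ * θ := mul_le_mul_of_nonneg_left hω hc₀.le
          _ < ε := hθε
    · -- interior points `s' > 0`
      have hzQ : ((s', y) : ℝ × (EuclideanSpace ℝ (Fin 3))) ∈ Q := ⟨⟨hspos, hs'.2⟩, hy⟩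
      have hev : u =ᶠ[𝓝 ((s', y) : ℝ × (EuclideanSpace ℝ (Fin 3)))] ut := by
        filter_upwards [(isOpen_lt continuous_const continuous_fst).mem_nhds
          (show (0 : ℝ) < ((s', y) : ℝ × (EuclideanSpace ℝ (Fin 3))).1 from hspos)] with z hz
        exact if_pos hz
      exact ((hutcQ _ hzQ).congr_of_eventuallyEq hev).continuousWithinAt
  -- ### backward uniqueness
  have hzero := Carleman.backwardUniqueness_uncurried_c12 (E := (EuclideanSpace ℝ (Fin 3))) (F := (EuclideanSpace ℝ (Fin 3)))
    uniqueContinuation_input_c12 he (c₁ := 2 * K) (M := 0) (by positivity) le_rfl hu1 hux hcont h0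
    hBH hgrowth hH3
  -- ### conclusion
  rintro ⟨t, x⟩ ⟨ht, hx⟩
  set z : ℝ × (EuclideanSpace ℝ (Fin 3)) := (-t, x - x₀) with hzdef
  have hxH : x - x₀ ∈ H := by
    show 0 < ⟪x - x₀, e⟫
    rw [inner_sub_left]
    exact sub_pos.2 hx
  have hzQ : z ∈ Q := ⟨⟨by linarith [ht.2], by linarith [ht.1]⟩, hxH⟩
  have h := hzero z hzQ
  rw [huQ z hzQ, hutdef] at h
  have h' : (uncurry (vorticity U)) (A z) = 0 := by
    rcases smul_eq_zero.1 h with h1 | h1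
    · exact absurd h1 hc₀.ne'
    · exact h1
  have hAz : A z = (t, x) := by
    rw [hA]; simp [hzdef]
  rw [hAz] at h'
  simpa [vorticity_apply] using h'

end Summit.NavierStokesRegularity.NavierStokesRegularity.Theorems.RellichScarApexLocalisationHalfspaceFarFieldCurlOfTopCurl

end
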